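import Literature.AlgebraicGeometry.ShimuraVarieties.UnitaryShimuraCurveRecord
import Literature.AlgebraicGeometry.Motives.AlgPointsNonempty
import HarnessLib

/-!
# The record unitary Shimura curve `M_K` is non-empty (Liu 2021, App. C (F2); Deligne 2.1.2)

Topic `Literature/AlgebraicGeometry/ShimuraVarieties`; namespace `Literature.AlgebraicGeometry.ShimuraVarieties.UnitaryCanonicalModel.RecordSystemGS`.
PROOF FILE (theorems only; no definition, no named fact, no instance, no `sorry`).  Cell `hodgecm-mathlib` (D-0151), FLOOR-0 P5a,
D9op road 2′ (`Cruxes/HLiu418/Lines/F0_D9opRoad2.lean` ed. 3, registered stub `stub_N : RecordCurveNonempty`): the generation theorem ★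
`Albanese.generates_α` (p792901) needs `[Nonempty X.left]`, and for the record curve `X = M⋆_K = (CMgsm …).X K = S.M.obj K` (★
`sec42DataGSM_X`, `rfl`) this is supplied HERE, for EVERY record system `S : RecordSystemGS L J⋆ τ K₀` and every level `K`:

* `RecordSystemGS.nonempty_complexPoints_baseChange` — the complex curve `(M_K)_τ` has a complex point: field (F2b) `hol` of the record
  gives a (holomorphic) map `u : ℂ² → (M_K)_τ(ℂ)` (the uniformisation `v ↦ [v, aK]` extended to all of `ℂ²`), and `ℂ²` is non-empty;
* `RecordSystemGS.nonempty_algPoints` — hence a `ℂ`-point of `M_K` over `L` along `τ` (★ `AlgPoints.baseChangeEquiv`);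
* **`RecordSystemGS.nonempty_obj_left`** — hence the scheme `M_K` is non-empty (★ `AlgPoints.nonempty_left_of_nonempty`).

(The expected road «a negative vector `v` of `J⋆^τ` and the point `(pts K).symm [v, K]`» needs the signature of `J⋆` at `τ` to be indefinite,
which the structure does not record as a field; the field `hol` makes the conclusion unconditional.)  With ★ `sec42DataGSM_X` the lead's
fold is `theorem stub_N : RecordCurveNonempty := fun F _ _ _ ι₁ Jstar K₀ S h4 isoₛ K => S.nonempty_obj_left K`.

HC_CM is proved only modulo the 7 printed citations until rung 0 closes; nothing of [Liu2021] is asserted here.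

## References
* [Liu2021] Y. Liu, *Fourier–Jacobi cycles and arithmetic relative trace formula*, Camb. J. Math. 9 (2021) = arXiv:2102.11518, App. C
  l. 4656–4660 and §C.1 (F2) (complex uniformisation of `Sh(𝕍)_K`).
* [Deligne1979ShimuraVarieties] P. Deligne, *Variétés de Shimura*, PSPM XXXIII.2 (1979), 2.1.2 (`Sh_K(ℂ) = G(ℚ)\X × G(𝔸_f)/K`).
* [GortzWedhorn2020] U. Görtz, T. Wedhorn, *Algebraic Geometry I*, 2nd ed. (2020), §(5.2) (points with values in a field).
-/

set_option autoImplicit false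

noncomputable section

open CategoryTheory NumberField
open Literature.AlgebraicGeometry.Motives
open Literature.NumberTheory.Automorphic Literature.NumberTheory.Automorphic.UnitaryGroup
open Literature.NumberTheory.Automorphic.Liu2021.AppendixC (C5.OpenCompactSubgroup C5.SmallLevel)

namespace Literature.AlgebraicGeometry.ShimuraVarieties.UnitaryCanonicalModel.RecordSystemGS

variable {L : Type} [Field L] [NumberField L] [IsCMField L] {Jstar : Matrix (Fin 2) (Fin 2) L} {τ : L →+* ℂ}
  {K₀ : C5.OpenCompactSubgroup ↥(finAdelic (↥(maximalRealSubfield L)) L (IsCMField.complexConj L) 2 Jstar)}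
  (S : RecordSystemGS L Jstar τ K₀) (K : C5.SmallLevel K₀)

/-- **The complex curve `(M_K)_τ = M_K ⊗_{L,τ} ℂ` has a complex point**: the record's field (F2b) `hol` provides a map
`u : ℂ² → (M_K)_τ(ℂ)`, and `ℂ²` is non-empty. [cite: Liu2021, App. C (F2) (FJcycle.tex l. 4656–4660)] [cite: Deligne1979ShimuraVarieties, 2.1.2] -/
theorem nonempty_complexPoints_baseChange : Nonempty (ComplexPoints ((Motives.baseChangeHom τ).obj (S.M.obj K))) := by
  letI : Algebra L ℂ := τ.toAlgebra
  obtain ⟨u, -⟩ := S.hol K 1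
  exact ⟨u 0⟩

/-- **`M_K` has a `ℂ`-point over `L` (along `τ`)**: transport of the previous point along ★ `AlgPoints.baseChangeEquiv τ`
(`M_K(ℂ) ≃ (M_K)_τ(ℂ)`). [cite: Liu2021, App. C (F2) (FJcycle.tex l. 4656–4660)] [cite: GortzWedhorn2020, §(5.2)] -/
theorem nonempty_algPoints : letI : Algebra L ℂ := τ.toAlgebra; Nonempty (AlgPoints (S.M.obj K) ℂ) := by
  letI : Algebra L ℂ := τ.toAlgebra
  obtain ⟨P⟩ := S.nonempty_complexPoints_baseChange K
  exact ⟨(AlgPoints.baseChangeEquiv τ (S.M.obj K)).symm P⟩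

/-- **The record curve `M_K` is a NON-EMPTY scheme**, for every record system and every level (a `ℂ`-point has an underlying point;
★ `AlgPoints.nonempty_left_of_nonempty`).  Through ★ `sec42DataGSM_X` (`rfl`) this is `Nonempty ((sec42DataGSM S h4 iso).X K).left`, the
letter `RecordCurveNonempty` of `Cruxes/HLiu418/Lines/F0_D9opRoad2.lean` ed. 3. [cite: Liu2021, App. C (F2) (FJcycle.tex l. 4656–4660)]
[cite: GortzWedhorn2020, §(5.2)] -/
theorem nonempty_obj_left : Nonempty (S.M.obj K).left := by
  letI : Algebra L ℂ := τ.toAlgebra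
  exact AlgPoints.nonempty_left_of_nonempty (S.M.obj K) ℂ (S.nonempty_algPoints K)

end Literature.AlgebraicGeometry.ShimuraVarieties.UnitaryCanonicalModel.RecordSystemGS

end
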